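import Summits.FinalStateConjecture.FinalStateConjecture.Theorems.ZeroEnergyKerrOrBombErgoregionBombModTOffWallReduction
import Literature.Geometry.Lorentzian.AxisymmetricBlackHoleUniquenessProofs

/-!
# `ErgoregionBombModT` — Killing light points avoid the Killing–timelike collar
# (crux stmt-FinalStateConjecture-17838, line `killing-light-points`, cycle c1)

Route `ZeroEnergyKerrOrBomb` of the Final State Conjecture, crux
`Summit.FinalStateConjecture.FinalStateConjecture.Theses.ZeroEnergyKerrOrBomb.ErgoregionBombModT`.
The landed reduction `ergoregionBombModT_of_offWall_of_noDocLightPoints` (this directory, p135563)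
splits the crux into the off-wall bomb and the pointwise statement `NoDocLightPoints`: at no point
`p` of the domain of outer communications with `g(T,T)(p) = 0` is `∇_T T = κ T`.  This file uses the
crux's own Killing–timelike COLLAR `(U, K)` — `K` Killing on the open `U ⊇ 𝓔⁺`, `[T, K] = 0` on
`U`, `K` timelike on `U ∩ ⟨⟨M_ext⟩⟩` — to dispose of one species of light point outright and to
reshape the residue:

* `smul_val_killing_collar_eq_zero` (pointwise identity): if `∇_T T = κ T` at `p` and `K` is a
  Killing field near `p` commuting with `T` at `p`, then `κ · g(T, K)(p) = 0`.  Proof: the Killing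
  equation of `K` on the pair `(T, T)` gives `g(T, ∇_T K) = 0`; torsion-freeness and `[T,K](p) = 0`
  give `∇_K T = ∇_T K`; the Killing equation of `T` on `(T, K)` gives
  `g(∇_T T, K) = -g(T, ∇_K T) = 0`, i.e. `κ g(T,K) = 0`.
* `leviCivita_self_ne_smul_of_collar`: hence at a point where `K` is timelike and `T` is null and
  non-zero (a timelike vector is never orthogonal to a non-zero null one, O'Neill 1983 Ch. 5
  Lemma 5.26) there is NO light point with `κ ≠ 0` — the incomplete (red- or blue-shifted, Hájíček
  1973 / Hawking–Ellis p. 331) Killing light lines never meet the collar.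
* `stub_noCollarIncompleteLightPoints`: the same, in the crux's telescope prefix (the closed stub W4
  of the registered skeleton `Lines/killing_light_points.lean`).
* `noDocLightPoints_of_belt_of_hovering`: `NoDocLightPoints` (verbatim the hypothesis `hNo` of the
  landed reduction) follows from three residual statements in the crux's telescope —
  no INCOMPLETE light point off the collar (`p ∉ U`, `κ ≠ 0`), no HOVERING light point off the
  collar (`p ∉ U`, `∇_T T = 0`), no hovering light point inside the collar (`p ∈ U ∩ doc`,
  `∇_T T = 0`) — the fourth case being the theorem above.
* `ergoregionBombModT_of_offWall_of_belt_of_hovering`: the crux (its body VERBATIM, Theses-free)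
  from the off-wall bomb and the three residual statements.

None of the three residual statements admits a pointwise proof: flat space carries the commuting
Killing pair `T = ∂ₜ + ∂ₓ` (null, geodesic: every point a hovering light point), `K = ∂ₜ`
(timelike), and the Killing field `x∂ₜ + t∂ₓ + a(y∂_z − z∂_y)` of Minkowski space has the isolated
incomplete light lines `t = ±x, y = z = 0` (`κ = ±1`).  They are statements about the GLOBAL
structure of the stationary limit surface of the hole (index of the second null direction field on
`Σ_e/T`, Hájíček 1973; Hawking–Ellis 1973 §9.3 p. 331), recorded here as hypotheses only.

References: B. O'Neill, *Semi-Riemannian geometry* (1983), Ch. 3 Thm. 3.11, Ch. 5 Lemma 5.26,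
Ch. 9 Prop. 9.25; S. W. Hawking, G. F. R. Ellis (1973), §9.3 p. 331; P. Hájíček, Phys. Rev. D 7
(1973) 2311; crux workfiles `Cruxes/ErgoregionBombModT/Ideas/killing-light-points.md`,
`Lines/killing_light_points.lean`.
-/

noncomputable section

open Bundle Set Filter Function
open scoped Manifold Topology

-- summit = problem name (D-0017)
set_option linter.dupNamespace false

namespace Summit.FinalStateConjecture.FinalStateConjecture.Theorems.ErgoregionBombModT

open Literature.Geometry.Lorentzian

section Collar

variable {𝓑 : StationaryAFBlackHole.{0}} [𝓑.metric.HasLeviCivita]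

/-- **`κ · g(T, K) = 0` at a pregeodesic point of `T`, for a commuting Killing field `K`.**  If
`∇_T T = κ T` at `p`, and `K` is differentiable at `p`, satisfies the Killing equation at `p` and
`[T, K](p) = 0`, then `κ g(T, K)(p) = 0`: the Killing equation of `K` on `(T, T)` gives
`g(T, ∇_T K) = 0`, torsion-freeness gives `∇_K T = ∇_T K`
(`leviCivita_apply_comm_of_mlieBracket_eq_zero`), and the Killing equation of `T` on `(T, K)` gives
`g(∇_T T, K) = -g(T, ∇_K T) = 0`.  O'Neill 1983, Ch. 9, Prop. 9.25 (Killing equation) and Ch. 3,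
Thm. 3.11 (torsion). -/
theorem smul_val_killing_collar_eq_zero {p : 𝓑.carrier}
    {K : Π x : 𝓑.carrier, TangentSpace (𝓡 4) x} {κ : ℝ}
    (hK : MDifferentiableAt (𝓡 4) (𝓡 4).tangent
      (fun x ↦ (TotalSpace.mk' E4 x (K x) : TangentBundle (𝓡 4) 𝓑.carrier)) p)
    (hKill : ∀ v w : TangentSpace (𝓡 4) p, 𝓑.metric.val p (𝓑.metric.leviCivita K p v) w +
      𝓑.metric.val p v (𝓑.metric.leviCivita K p w) = 0)
    (hcomm : VectorField.mlieBracket (𝓡 4) 𝓑.killing K p = 0)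
    (hacc : 𝓑.metric.leviCivita 𝓑.killing p (𝓑.killing p) = κ • 𝓑.killing p) :
    κ * 𝓑.metric.val p (𝓑.killing p) (K p) = 0 := by
  -- `T` is differentiable at `p`
  have hT1 : ContMDiff (𝓡 4) (𝓡 4).tangent 1
      (fun x ↦ (⟨x, 𝓑.killing x⟩ : TangentBundle (𝓡 4) 𝓑.carrier)) :=
    𝓑.isStationaryKilling.isKillingField.contMDiff.of_le (WithTop.coe_le_coe.mpr le_top)
  have hT : MDifferentiableAt (𝓡 4) (𝓡 4).tangent
      (fun x ↦ (TotalSpace.mk' E4 x (𝓑.killing x) : TangentBundle (𝓡 4) 𝓑.carrier)) p :=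
    hT1.mdifferentiableAt one_ne_zero
  -- torsion-freeness: `∇_T K = ∇_K T` at `p`
  have hsym : 𝓑.metric.leviCivita K p (𝓑.killing p) = 𝓑.metric.leviCivita 𝓑.killing p (K p) :=
    PseudoRiemannianMetric.leviCivita_apply_comm_of_mlieBracket_eq_zero hT hK hcomm
  -- Killing equation of `K` on `(T, T)`: `g(T, ∇_T K) = 0`
  have h1 := hKill (𝓑.killing p) (𝓑.killing p)
  rw [𝓑.metric.symm p (𝓑.metric.leviCivita K p (𝓑.killing p)) (𝓑.killing p)] at h1
  have h1' : 𝓑.metric.val p (𝓑.killing p) (𝓑.metric.leviCivita K p (𝓑.killing p)) = 0 := by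
    linarith
  -- Killing equation of `T` on `(T, K)`: `g(∇_T T, K) + g(T, ∇_K T) = 0`
  have h2 := 𝓑.isStationaryKilling.isKillingField.val_leviCivita_add p (𝓑.killing p) (K p)
  rw [hacc, ← hsym, h1', add_zero, map_smul] at h2
  simpa using h2

/-- **No incomplete Killing light point in the Killing–timelike collar.**  At a point `p` where
the stationary Killing field `T` is null and non-zero and a Killing field `K` (differentiable at
`p`, Killing equation at `p`, `[T, K](p) = 0`) is TIMELIKE, `∇_T T = κ T` is impossible for every
`κ ≠ 0`: by `smul_val_killing_collar_eq_zero` it would force `g(T, K)(p) = 0`, but a timelike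
vector is orthogonal to no non-zero null vector (O'Neill 1983, Ch. 5, Lemma 5.26 —
`LorentzianMetric.pos_of_orthogonal`).  So the red- or blue-shifted Killing light lines of the
stationary limit surface (Hawking–Ellis 1973, §9.3 p. 331, after Hájíček 1973) never meet the
crux's collar `U ∩ ⟨⟨M_ext⟩⟩`. -/
theorem leviCivita_self_ne_smul_of_collar {p : 𝓑.carrier}
    {K : Π x : 𝓑.carrier, TangentSpace (𝓡 4) x} {κ : ℝ}
    (hK : MDifferentiableAt (𝓡 4) (𝓡 4).tangent
      (fun x ↦ (TotalSpace.mk' E4 x (K x) : TangentBundle (𝓡 4) 𝓑.carrier)) p)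
    (hKill : ∀ v w : TangentSpace (𝓡 4) p, 𝓑.metric.val p (𝓑.metric.leviCivita K p v) w +
      𝓑.metric.val p v (𝓑.metric.leviCivita K p w) = 0)
    (hcomm : VectorField.mlieBracket (𝓡 4) 𝓑.killing K p = 0)
    (hKt : 𝓑.metric.val p (K p) (K p) < 0)
    (hlam : 𝓑.metric.val p (𝓑.killing p) (𝓑.killing p) = 0) (hT0 : 𝓑.killing p ≠ 0)
    (hκ : κ ≠ 0) :
    𝓑.metric.leviCivita 𝓑.killing p (𝓑.killing p) ≠ κ • 𝓑.killing p := by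
  intro hacc
  have h := smul_val_killing_collar_eq_zero hK hKill hcomm hacc
  have hTK : 𝓑.metric.val p (𝓑.killing p) (K p) = 0 := (mul_eq_zero.mp h).resolve_left hκ
  have hKT : 𝓑.metric.val p (K p) (𝓑.killing p) = 0 := (𝓑.metric.symm p _ _).trans hTK
  have hpos := 𝓑.metric.pos_of_orthogonal p (K p) (𝓑.killing p) hKt hKT hT0
  rw [hlam] at hpos
  exact lt_irrefl 0 hpos

end Collar

/-! ### The closed species, in the crux's telescope (registered stub `stub_noCollarIncompleteLightPoints`) -/

/-- **Stub W4 of line `killing-light-points` — no incomplete Killing light point inside the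
collar.**  In the telescope of `ErgoregionBombModT`: at no `p ∈ U ∩ ⟨⟨M_ext⟩⟩` with `g(T,T)(p) = 0`
is `∇_T T = κ T` with `κ ≠ 0` (`leviCivita_self_ne_smul_of_collar`: the collar field `K` is smooth
on the open `U`, Killing and commuting with `T` there, timelike on `U ∩ ⟨⟨M_ext⟩⟩`, and `T ≠ 0` on
the d.o.c.).  O'Neill 1983, Ch. 5 Lemma 5.26 and Ch. 9 Prop. 9.25. -/
theorem stub_noCollarIncompleteLightPoints :
    ∀ (𝓑 : Literature.Geometry.Lorentzian.StationaryAFBlackHole.{0}) [𝓑.metric.HasLeviCivita] [Literature.Geometry.Lorentzian.Kerr.Facts], 𝓑.metric.toPseudoRiemannianMetric.IsRicciFlat → 𝓑.IsIPlusRegular → (∀ p : 𝓑.carrier, p ∈ 𝓑.metric.chronologicalFuture 𝓑.timeOrientation 𝓑.Mext) → (∀ p ∈ 𝓑.doc, 𝓑.killing p ≠ 0) → SimplyConnectedSpace 𝓑.doc → ∀ (U : Set 𝓑.carrier) (K : Π x : 𝓑.carrier, TangentSpace (𝓡 4) x), IsOpen U → 𝓑.horizon ⊆ U → IsConnected 𝓑.horizon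 → ContMDiffOn (𝓡 4) ((𝓡 4).prod 𝓘(ℝ, Literature.Geometry.Lorentzian.E4)) ((⊤ : ℕ∞) : WithTop ℕ∞) (fun x ↦ (Bundle.TotalSpace.mk' Literature.Geometry.Lorentzian.E4 x (K x) : TangentBundle (𝓡 4) 𝓑.carrier)) U → (∀ x ∈ U, ∀ v w : TangentSpace (𝓡 4) x, 𝓑.metric.val x (𝓑.metric.leviCivita K x v) w + 𝓑.metric.val x v (𝓑.metric.leviCivita K x w) = 0) → (∀ x ∈ U, VectorField.mlieBracket (𝓡 4) 𝓑.killing K x = 0) → (∀ p ∈ 𝓑.horizon, K p ≠ 0) → (∀ γ : ℝ → 𝓑.carrier, IsMIntegralCurve γ K → γ 0 ∈ 𝓑.horizon → ∀ t, γ t ∈ 𝓑.horizon) → (∀ x ∈ U ∩ 𝓑.doc, 𝓑.metric.val x (K x) (K x) < 0) → (∃ S₀ : Set 𝓑.carrier, IsCompact S₀ ∧ S₀ ⊆ 𝓑.doc ∧ ∀ y ∈ 𝓑.doc, 0 ≤ 𝓑.metric.val y (𝓑.killing y) (𝓑.killing y) → y ∉ U → y ∈ Literature.Geometry.Lorentzian.stationaryOrbit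 𝓑.killing S₀) → ∀ p ∈ U ∩ 𝓑.doc, 𝓑.metric.val p (𝓑.killing p) (𝓑.killing p) = 0 → ∀ κ : ℝ, κ ≠ 0 → 𝓑.metric.leviCivita 𝓑.killing p (𝓑.killing p) ≠ κ • 𝓑.killing p := by
  intro 𝓑 _ _ hRic hReg hpres hT0 hsc U K hU hHU hconn hKs hKill hcomm hK0 hKtan hKtime hbelt p hp hlam κ hκ
  have hKp : MDifferentiableAt (𝓡 4) (𝓡 4).tangent
      (fun x ↦ (TotalSpace.mk' E4 x (K x) : TangentBundle (𝓡 4) 𝓑.carrier)) p :=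
    (hKs.contMDiffAt (hU.mem_nhds hp.1)).mdifferentiableAt (by simp)
  exact leviCivita_self_ne_smul_of_collar hKp (hKill p hp.1) (hcomm p hp.1) (hKtime p hp) hlam
    (hT0 p hp.2) hκ

/-! ### The reshaped residue of `NoDocLightPoints` -/

/-- **`NoDocLightPoints` from its three residual species.**  In the telescope of the crux, the
statement "no Killing light point in the domain of outer communications" (hypothesis `hNo` of
`ergoregionBombModT_of_offWall_of_noDocLightPoints`, verbatim) follows from: no incomplete light
point off the collar (`hInc`: `p ∉ U`, `κ ≠ 0`), no hovering light point off the collar (`hHovB`: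
`p ∉ U`, `∇_T T = 0`) and no hovering light point inside the collar (`hHovC`: `p ∈ U ∩ doc`,
`∇_T T = 0`); the remaining case — an incomplete light point inside the collar — is excluded by
`leviCivita_self_ne_smul_of_collar` (the collar field `K` is smooth on the open `U`, Killing and
commuting with `T` there, timelike on `U ∩ ⟨⟨M_ext⟩⟩`, and `T ≠ 0` on the d.o.c.). -/
theorem noDocLightPoints_of_belt_of_hovering
    (hInc : ∀ (𝓑 : Literature.Geometry.Lorentzian.StationaryAFBlackHole.{0}) [𝓑.metric.HasLeviCivita] [Literature.Geometry.Lorentzian.Kerr.Facts], 𝓑.metric.toPseudoRiemannianMetric.IsRicciFlat → 𝓑.IsIPlusRegular → (∀ p : 𝓑.carrier, p ∈ 𝓑.metric.chronologicalFuture 𝓑.timeOrientation 𝓑.Mext) → (∀ p ∈ 𝓑.doc, 𝓑.killing p ≠ 0) → SimplyConnectedSpace 𝓑.doc → ∀ (U : Set 𝓑.carrier) (K : Π x : 𝓑.carrier, TangentSpace (𝓡 4) x), IsOpen U → 𝓑.horizon ⊆ U → IsConnected 𝓑.horizon → ContMDiffOn (𝓡 4) ((𝓡 4).prod 𝓘(ℝ,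 Literature.Geometry.Lorentzian.E4)) ((⊤ : ℕ∞) : WithTop ℕ∞) (fun x ↦ (Bundle.TotalSpace.mk' Literature.Geometry.Lorentzian.E4 x (K x) : TangentBundle (𝓡 4) 𝓑.carrier)) U → (∀ x ∈ U, ∀ v w : TangentSpace (𝓡 4) x, 𝓑.metric.val x (𝓑.metric.leviCivita K x v) w + 𝓑.metric.val x v (𝓑.metric.leviCivita K x w) = 0) → (∀ x ∈ U, VectorField.mlieBracket (𝓡 4) 𝓑.killing K x = 0) → (∀ p ∈ 𝓑.horizon, K p ≠ 0) → (∀ γ : ℝ → 𝓑.carrier, IsMIntegralCurve γ K → γ 0 ∈ 𝓑.horizon → ∀ t, γ t ∈ 𝓑.horizon) → (∀ x ∈ U ∩ 𝓑.doc, 𝓑.metric.val x (K x) (K x) < 0) → (∃ S₀ : Set 𝓑.carrier, IsCompact S₀ ∧ S₀ ⊆ 𝓑.doc ∧ ∀ y ∈ 𝓑.doc, 0 ≤ 𝓑.metric.val y (𝓑.killing y) (𝓑.killing y) → y ∉ U → y ∈ Literature.Geometry.Lorentzian.stationaryOrbit 𝓑.killing S₀) → ∀ p ∈ 𝓑.doc,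 p ∉ U → 𝓑.metric.val p (𝓑.killing p) (𝓑.killing p) = 0 → ∀ κ : ℝ, κ ≠ 0 → 𝓑.metric.leviCivita 𝓑.killing p (𝓑.killing p) ≠ κ • 𝓑.killing p)
    (hHovB : ∀ (𝓑 : Literature.Geometry.Lorentzian.StationaryAFBlackHole.{0}) [𝓑.metric.HasLeviCivita] [Literature.Geometry.Lorentzian.Kerr.Facts], 𝓑.metric.toPseudoRiemannianMetric.IsRicciFlat → 𝓑.IsIPlusRegular → (∀ p : 𝓑.carrier, p ∈ 𝓑.metric.chronologicalFuture 𝓑.timeOrientation 𝓑.Mext) → (∀ p ∈ 𝓑.doc, 𝓑.killing p ≠ 0) → SimplyConnectedSpace 𝓑.doc → ∀ (U : Set 𝓑.carrier) (K : Π x : 𝓑.carrier, TangentSpace (𝓡 4) x), IsOpen U → 𝓑.horizon ⊆ U → IsConnected 𝓑.horizon → ContMDiffOn (𝓡 4) ((𝓡 4).prod 𝓘(ℝ, Literature.Geometry.Lorentzian.E4)) ((⊤ : ℕ∞) : WithTop ℕ∞) (fun x ↦ (Bundle.TotalSpace.mk' Literature.Geometry.Lorentzian.E4 x (K x) : TangentBundle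 (𝓡 4) 𝓑.carrier)) U → (∀ x ∈ U, ∀ v w : TangentSpace (𝓡 4) x, 𝓑.metric.val x (𝓑.metric.leviCivita K x v) w + 𝓑.metric.val x v (𝓑.metric.leviCivita K x w) = 0) → (∀ x ∈ U, VectorField.mlieBracket (𝓡 4) 𝓑.killing K x = 0) → (∀ p ∈ 𝓑.horizon, K p ≠ 0) → (∀ γ : ℝ → 𝓑.carrier, IsMIntegralCurve γ K → γ 0 ∈ 𝓑.horizon → ∀ t, γ t ∈ 𝓑.horizon) → (∀ x ∈ U ∩ 𝓑.doc, 𝓑.metric.val x (K x) (K x) < 0) → (∃ S₀ : Set 𝓑.carrier, IsCompact S₀ ∧ S₀ ⊆ 𝓑.doc ∧ ∀ y ∈ 𝓑.doc, 0 ≤ 𝓑.metric.val y (𝓑.killing y) (𝓑.killing y) → y ∉ U → y ∈ Literature.Geometry.Lorentzian.stationaryOrbit 𝓑.killing S₀) → ∀ p ∈ 𝓑.doc, p ∉ U → 𝓑.metric.val p (𝓑.killing p) (𝓑.killing p) = 0 → 𝓑.metric.leviCivita 𝓑.killing p (𝓑.killing p) ≠ 0)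
    (hHovC : ∀ (𝓑 : Literature.Geometry.Lorentzian.StationaryAFBlackHole.{0}) [𝓑.metric.HasLeviCivita] [Literature.Geometry.Lorentzian.Kerr.Facts], 𝓑.metric.toPseudoRiemannianMetric.IsRicciFlat → 𝓑.IsIPlusRegular → (∀ p : 𝓑.carrier, p ∈ 𝓑.metric.chronologicalFuture 𝓑.timeOrientation 𝓑.Mext) → (∀ p ∈ 𝓑.doc, 𝓑.killing p ≠ 0) → SimplyConnectedSpace 𝓑.doc → ∀ (U : Set 𝓑.carrier) (K : Π x : 𝓑.carrier, TangentSpace (𝓡 4) x), IsOpen U → 𝓑.horizon ⊆ U → IsConnected 𝓑.horizon → ContMDiffOn (𝓡 4) ((𝓡 4).prod 𝓘(ℝ, Literature.Geometry.Lorentzian.E4)) ((⊤ : ℕ∞) : WithTop ℕ∞) (fun x ↦ (Bundle.TotalSpace.mk' Literature.Geometry.Lorentzian.E4 x (K x) : TangentBundle (𝓡 4) 𝓑.carrier)) U → (∀ x ∈ U, ∀ v w : TangentSpace (𝓡 4) x, 𝓑.metric.val x (𝓑.metric.leviCivita K x v) w + 𝓑.metric.val x v (𝓑.metric.leviCivita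 K x w) = 0) → (∀ x ∈ U, VectorField.mlieBracket (𝓡 4) 𝓑.killing K x = 0) → (∀ p ∈ 𝓑.horizon, K p ≠ 0) → (∀ γ : ℝ → 𝓑.carrier, IsMIntegralCurve γ K → γ 0 ∈ 𝓑.horizon → ∀ t, γ t ∈ 𝓑.horizon) → (∀ x ∈ U ∩ 𝓑.doc, 𝓑.metric.val x (K x) (K x) < 0) → (∃ S₀ : Set 𝓑.carrier, IsCompact S₀ ∧ S₀ ⊆ 𝓑.doc ∧ ∀ y ∈ 𝓑.doc, 0 ≤ 𝓑.metric.val y (𝓑.killing y) (𝓑.killing y) → y ∉ U → y ∈ Literature.Geometry.Lorentzian.stationaryOrbit 𝓑.killing S₀) → ∀ p ∈ U ∩ 𝓑.doc, 𝓑.metric.val p (𝓑.killing p) (𝓑.killing p) = 0 → 𝓑.metric.leviCivita 𝓑.killing p (𝓑.killing p) ≠ 0) :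
    ∀ (𝓑 : Literature.Geometry.Lorentzian.StationaryAFBlackHole.{0}) [𝓑.metric.HasLeviCivita] [Literature.Geometry.Lorentzian.Kerr.Facts], 𝓑.metric.toPseudoRiemannianMetric.IsRicciFlat → 𝓑.IsIPlusRegular → (∀ p : 𝓑.carrier, p ∈ 𝓑.metric.chronologicalFuture 𝓑.timeOrientation 𝓑.Mext) → (∀ p ∈ 𝓑.doc, 𝓑.killing p ≠ 0) → SimplyConnectedSpace 𝓑.doc → ∀ (U : Set 𝓑.carrier) (K : Π x : 𝓑.carrier, TangentSpace (𝓡 4) x), IsOpen U → 𝓑.horizon ⊆ U → IsConnected 𝓑.horizon → ContMDiffOn (𝓡 4) ((𝓡 4).prod 𝓘(ℝ, Literature.Geometry.Lorentzian.E4)) ((⊤ : ℕ∞) : WithTop ℕ∞) (fun x ↦ (Bundle.TotalSpace.mk' Literature.Geometry.Lorentzian.E4 x (K x) : TangentBundle (𝓡 4) 𝓑.carrier)) U → (∀ x ∈ U, ∀ v w : TangentSpace (𝓡 4) x, 𝓑.metric.val x (𝓑.metric.leviCivita K x v) w + 𝓑.metric.val x v (𝓑.metric.leviCivita K x w) = 0)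 → (∀ x ∈ U, VectorField.mlieBracket (𝓡 4) 𝓑.killing K x = 0) → (∀ p ∈ 𝓑.horizon, K p ≠ 0) → (∀ γ : ℝ → 𝓑.carrier, IsMIntegralCurve γ K → γ 0 ∈ 𝓑.horizon → ∀ t, γ t ∈ 𝓑.horizon) → (∀ x ∈ U ∩ 𝓑.doc, 𝓑.metric.val x (K x) (K x) < 0) → (∃ S₀ : Set 𝓑.carrier, IsCompact S₀ ∧ S₀ ⊆ 𝓑.doc ∧ ∀ y ∈ 𝓑.doc, 0 ≤ 𝓑.metric.val y (𝓑.killing y) (𝓑.killing y) → y ∉ U → y ∈ Literature.Geometry.Lorentzian.stationaryOrbit 𝓑.killing S₀) → ∀ p ∈ 𝓑.doc, 𝓑.metric.val p (𝓑.killing p) (𝓑.killing p) = 0 → ∀ κ : ℝ, 𝓑.metric.leviCivita 𝓑.killing p (𝓑.killing p) ≠ κ • 𝓑.killing p := by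
  intro 𝓑 _ _ hRic hReg hpres hT0 hsc U K hU hHU hconn hKs hKill hcomm hK0 hKtan hKtime hbelt p hp hlam κ hacc
  by_cases hpU : p ∈ U
  · by_cases hκ : κ = 0
    · rw [hκ, zero_smul] at hacc
      exact hHovC 𝓑 hRic hReg hpres hT0 hsc U K hU hHU hconn hKs hKill hcomm hK0 hKtan hKtime hbelt p
        ⟨hpU, hp⟩ hlam hacc
    · exact stub_noCollarIncompleteLightPoints 𝓑 hRic hReg hpres hT0 hsc U K hU hHU hconn hKs hKill hcomm
        hK0 hKtan hKtime hbelt p ⟨hpU, hp⟩ hlam κ hκ hacc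
  · by_cases hκ : κ = 0
    · rw [hκ, zero_smul] at hacc
      exact hHovB 𝓑 hRic hReg hpres hT0 hsc U K hU hHU hconn hKs hKill hcomm hK0 hKtan hKtime hbelt p
        hp hpU hlam hacc
    · exact hInc 𝓑 hRic hReg hpres hT0 hsc U K hU hHU hconn hKs hKill hcomm hK0 hKtan hKtime hbelt p
        hp hpU hlam κ hκ hacc

/-- **`ErgoregionBombModT ⇐ OffWallBomb ∧ (no incomplete belt light point) ∧ (no hovering belt
light point) ∧ (no hovering collar light point)`** — the crux of route `ZeroEnergyKerrOrBomb`
(its body VERBATIM, so that the type δ-unfolds to `Theses.ZeroEnergyKerrOrBomb.ErgoregionBombModT`)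
from the off-wall bomb `hOff` and the three residual species of Killing light points, by the landed
wall/off-wall reduction `ergoregionBombModT_of_offWall_of_noDocLightPoints` (p135563) and
`noDocLightPoints_of_belt_of_hovering`. -/
theorem ergoregionBombModT_of_offWall_of_belt_of_hovering
    (hOff : ∀ (𝓑 : Literature.Geometry.Lorentzian.StationaryAFBlackHole.{0}) [𝓑.metric.HasLeviCivita] [Literature.Geometry.Lorentzian.Kerr.Facts], 𝓑.metric.toPseudoRiemannianMetric.IsRicciFlat → 𝓑.IsIPlusRegular → (∀ p : 𝓑.carrier, p ∈ 𝓑.metric.chronologicalFuture 𝓑.timeOrientation 𝓑.Mext) → (∀ p ∈ 𝓑.doc, 𝓑.killing p ≠ 0) → SimplyConnectedSpace 𝓑.doc → ∀ (U : Set 𝓑.carrier) (K : Π x : 𝓑.carrier, TangentSpace (𝓡 4) x), IsOpen U → 𝓑.horizon ⊆ U → IsConnected 𝓑.horizon → ContMDiffOn (𝓡 4) ((𝓡 4).prod 𝓘(ℝ, Literature.Geometry.Lorentzian.E4)) ((⊤ : ℕ∞) : WithTop ℕ∞) (fun x ↦ (Bundle.TotalSpace.mk' Literature.Geometry.Lorentzian.E4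 x (K x) : TangentBundle (𝓡 4) 𝓑.carrier)) U → (∀ x ∈ U, ∀ v w : TangentSpace (𝓡 4) x, 𝓑.metric.val x (𝓑.metric.leviCivita K x v) w + 𝓑.metric.val x v (𝓑.metric.leviCivita K x w) = 0) → (∀ x ∈ U, VectorField.mlieBracket (𝓡 4) 𝓑.killing K x = 0) → (∀ p ∈ 𝓑.horizon, K p ≠ 0) → (∀ γ : ℝ → 𝓑.carrier, IsMIntegralCurve γ K → γ 0 ∈ 𝓑.horizon → ∀ t, γ t ∈ 𝓑.horizon) → (∀ x ∈ U ∩ 𝓑.doc, 𝓑.metric.val x (K x) (K x) < 0) → (∃ S₀ : Set 𝓑.carrier, IsCompact S₀ ∧ S₀ ⊆ 𝓑.doc ∧ ∀ y ∈ 𝓑.doc, 0 ≤ 𝓑.metric.val y (𝓑.killing y) (𝓑.killing y) → y ∉ U → y ∈ Literature.Geometry.Lorentzian.stationaryOrbit 𝓑.killing S₀) → ∀ S : Set 𝓑.carrier, IsCompact S → S ⊆ 𝓑.doc → ∀ (γ : ℝ → 𝓑.carrier) (s : Set ℝ), Literature.Geometry.Lorentzian.IsMaximalGeodesicOn 𝓑.metric.toPseudoRiemannianMetric.leviCivita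 γ s → s.Nonempty → (∀ t ∈ s, 𝓑.metric.val (γ t) (Literature.Geometry.Lorentzian.velocity (𝓡 4) γ t) (Literature.Geometry.Lorentzian.velocity (𝓡 4) γ t) = 0 ∧ Literature.Geometry.Lorentzian.velocity (𝓡 4) γ t ≠ 0 ∧ 𝓑.metric.val (γ t) (Literature.Geometry.Lorentzian.velocity (𝓡 4) γ t) (𝓑.killing (γ t)) = 0) → (∀ t ∈ s, γ t ∈ Literature.Geometry.Lorentzian.stationaryOrbit 𝓑.killing S) → (∃ t ∈ s, 0 < 𝓑.metric.val (γ t) (𝓑.killing (γ t)) (𝓑.killing (γ t))) → ∃ (ν ω : ℝ) (ψ χ : 𝓑.carrier → ℝ), 0 < ν ∧ (∃ U : Set 𝓑.carrier, IsOpen U ∧ 𝓑.doc ∪ 𝓑.horizon ⊆ U ∧ ContMDiffOn (𝓡 4) 𝓘(ℝ, ℝ) ((⊤ : ℕ∞) : WithTop ℕ∞) ψ U ∧ ContMDiffOn (𝓡 4) 𝓘(ℝ, ℝ) ((⊤ : ℕ∞) : WithTop ℕ∞) χ U) ∧ (∀ x ∈ 𝓑.doc, 𝓑.metric.dalembertian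 ψ x = 0 ∧ 𝓑.metric.dalembertian χ x = 0) ∧ (∀ x ∈ 𝓑.doc, mfderiv (𝓡 4) 𝓘(ℝ, ℝ) ψ x (𝓑.killing x) = ν * ψ x - ω * χ x ∧ mfderiv (𝓡 4) 𝓘(ℝ, ℝ) χ x (𝓑.killing x) = ω * ψ x + ν * χ x) ∧ (∃ C : ℝ, ∀ x ∈ 𝓑.doc ∩ 𝓑.metric.chronologicalPast 𝓑.timeOrientation (𝓑.embed '' 𝓑.e.far (𝓑.e.R + 1)), |ψ x| ≤ C ∧ |χ x| ≤ C) ∧ ∃ x ∈ 𝓑.doc, ψ x ≠ 0 ∨ χ x ≠ 0)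
    (hInc : ∀ (𝓑 : Literature.Geometry.Lorentzian.StationaryAFBlackHole.{0}) [𝓑.metric.HasLeviCivita] [Literature.Geometry.Lorentzian.Kerr.Facts], 𝓑.metric.toPseudoRiemannianMetric.IsRicciFlat → 𝓑.IsIPlusRegular → (∀ p : 𝓑.carrier, p ∈ 𝓑.metric.chronologicalFuture 𝓑.timeOrientation 𝓑.Mext) → (∀ p ∈ 𝓑.doc, 𝓑.killing p ≠ 0) → SimplyConnectedSpace 𝓑.doc → ∀ (U : Set 𝓑.carrier) (K : Π x : 𝓑.carrier, TangentSpace (𝓡 4) x), IsOpen U → 𝓑.horizon ⊆ U → IsConnected 𝓑.horizon → ContMDiffOn (𝓡 4) ((𝓡 4).prod 𝓘(ℝ, Literature.Geometry.Lorentzian.E4)) ((⊤ : ℕ∞) : WithTop ℕ∞) (fun x ↦ (Bundle.TotalSpace.mk' Literature.Geometry.Lorentzian.E4 x (K x) : TangentBundle (𝓡 4) 𝓑.carrier)) U → (∀ x ∈ U, ∀ v w : TangentSpace (𝓡 4) x, 𝓑.metric.val x (𝓑.metric.leviCivita K x v) w + 𝓑.metric.val x v (𝓑.metric.leviCivita K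 x w) = 0) → (∀ x ∈ U, VectorField.mlieBracket (𝓡 4) 𝓑.killing K x = 0) → (∀ p ∈ 𝓑.horizon, K p ≠ 0) → (∀ γ : ℝ → 𝓑.carrier, IsMIntegralCurve γ K → γ 0 ∈ 𝓑.horizon → ∀ t, γ t ∈ 𝓑.horizon) → (∀ x ∈ U ∩ 𝓑.doc, 𝓑.metric.val x (K x) (K x) < 0) → (∃ S₀ : Set 𝓑.carrier, IsCompact S₀ ∧ S₀ ⊆ 𝓑.doc ∧ ∀ y ∈ 𝓑.doc, 0 ≤ 𝓑.metric.val y (𝓑.killing y) (𝓑.killing y) → y ∉ U → y ∈ Literature.Geometry.Lorentzian.stationaryOrbit 𝓑.killing S₀) → ∀ p ∈ 𝓑.doc, p ∉ U → 𝓑.metric.val p (𝓑.killing p) (𝓑.killing p) = 0 → ∀ κ : ℝ, κ ≠ 0 → 𝓑.metric.leviCivita 𝓑.killing p (𝓑.killing p) ≠ κ • 𝓑.killing p)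
    (hHovB : ∀ (𝓑 : Literature.Geometry.Lorentzian.StationaryAFBlackHole.{0}) [𝓑.metric.HasLeviCivita] [Literature.Geometry.Lorentzian.Kerr.Facts], 𝓑.metric.toPseudoRiemannianMetric.IsRicciFlat → 𝓑.IsIPlusRegular → (∀ p : 𝓑.carrier, p ∈ 𝓑.metric.chronologicalFuture 𝓑.timeOrientation 𝓑.Mext) → (∀ p ∈ 𝓑.doc, 𝓑.killing p ≠ 0) → SimplyConnectedSpace 𝓑.doc → ∀ (U : Set 𝓑.carrier) (K : Π x : 𝓑.carrier, TangentSpace (𝓡 4) x), IsOpen U → 𝓑.horizon ⊆ U → IsConnected 𝓑.horizon → ContMDiffOn (𝓡 4) ((𝓡 4).prod 𝓘(ℝ, Literature.Geometry.Lorentzian.E4)) ((⊤ : ℕ∞) : WithTop ℕ∞) (fun x ↦ (Bundle.TotalSpace.mk' Literature.Geometry.Lorentzian.E4 x (K x) : TangentBundle (𝓡 4) 𝓑.carrier)) U → (∀ x ∈ U, ∀ v w : TangentSpace (𝓡 4) x, 𝓑.metric.val x (𝓑.metric.leviCivita K x v) w + 𝓑.metric.val x v (𝓑.metric.leviCivita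 K x w) = 0) → (∀ x ∈ U, VectorField.mlieBracket (𝓡 4) 𝓑.killing K x = 0) → (∀ p ∈ 𝓑.horizon, K p ≠ 0) → (∀ γ : ℝ → 𝓑.carrier, IsMIntegralCurve γ K → γ 0 ∈ 𝓑.horizon → ∀ t, γ t ∈ 𝓑.horizon) → (∀ x ∈ U ∩ 𝓑.doc, 𝓑.metric.val x (K x) (K x) < 0) → (∃ S₀ : Set 𝓑.carrier, IsCompact S₀ ∧ S₀ ⊆ 𝓑.doc ∧ ∀ y ∈ 𝓑.doc, 0 ≤ 𝓑.metric.val y (𝓑.killing y) (𝓑.killing y) → y ∉ U → y ∈ Literature.Geometry.Lorentzian.stationaryOrbit 𝓑.killing S₀) → ∀ p ∈ 𝓑.doc, p ∉ U → 𝓑.metric.val p (𝓑.killing p) (𝓑.killing p) = 0 → 𝓑.metric.leviCivita 𝓑.killing p (𝓑.killing p) ≠ 0)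
    (hHovC : ∀ (𝓑 : Literature.Geometry.Lorentzian.StationaryAFBlackHole.{0}) [𝓑.metric.HasLeviCivita] [Literature.Geometry.Lorentzian.Kerr.Facts], 𝓑.metric.toPseudoRiemannianMetric.IsRicciFlat → 𝓑.IsIPlusRegular → (∀ p : 𝓑.carrier, p ∈ 𝓑.metric.chronologicalFuture 𝓑.timeOrientation 𝓑.Mext) → (∀ p ∈ 𝓑.doc, 𝓑.killing p ≠ 0) → SimplyConnectedSpace 𝓑.doc → ∀ (U : Set 𝓑.carrier) (K : Π x : 𝓑.carrier, TangentSpace (𝓡 4) x), IsOpen U → 𝓑.horizon ⊆ U → IsConnected 𝓑.horizon → ContMDiffOn (𝓡 4) ((𝓡 4).prod 𝓘(ℝ, Literature.Geometry.Lorentzian.E4)) ((⊤ : ℕ∞) : WithTop ℕ∞) (fun x ↦ (Bundle.TotalSpace.mk' Literature.Geometry.Lorentzian.E4 x (K x) : TangentBundle (𝓡 4) 𝓑.carrier)) U → (∀ x ∈ U, ∀ v w : TangentSpace (𝓡 4) x, 𝓑.metric.val x (𝓑.metric.leviCivita K x v) w + 𝓑.metric.val x v (𝓑.metric.leviCivita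 K x w) = 0) → (∀ x ∈ U, VectorField.mlieBracket (𝓡 4) 𝓑.killing K x = 0) → (∀ p ∈ 𝓑.horizon, K p ≠ 0) → (∀ γ : ℝ → 𝓑.carrier, IsMIntegralCurve γ K → γ 0 ∈ 𝓑.horizon → ∀ t, γ t ∈ 𝓑.horizon) → (∀ x ∈ U ∩ 𝓑.doc, 𝓑.metric.val x (K x) (K x) < 0) → (∃ S₀ : Set 𝓑.carrier, IsCompact S₀ ∧ S₀ ⊆ 𝓑.doc ∧ ∀ y ∈ 𝓑.doc, 0 ≤ 𝓑.metric.val y (𝓑.killing y) (𝓑.killing y) → y ∉ U → y ∈ Literature.Geometry.Lorentzian.stationaryOrbit 𝓑.killing S₀) → ∀ p ∈ U ∩ 𝓑.doc, 𝓑.metric.val p (𝓑.killing p) (𝓑.killing p) = 0 → 𝓑.metric.leviCivita 𝓑.killing p (𝓑.killing p) ≠ 0) :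
    ∀ (𝓑 : Literature.Geometry.Lorentzian.StationaryAFBlackHole.{0}) [𝓑.metric.HasLeviCivita] [Literature.Geometry.Lorentzian.Kerr.Facts], 𝓑.metric.toPseudoRiemannianMetric.IsRicciFlat → 𝓑.IsIPlusRegular → (∀ p : 𝓑.carrier, p ∈ 𝓑.metric.chronologicalFuture 𝓑.timeOrientation 𝓑.Mext) → (∀ p ∈ 𝓑.doc, 𝓑.killing p ≠ 0) → SimplyConnectedSpace 𝓑.doc → ∀ (U : Set 𝓑.carrier) (K : Π x : 𝓑.carrier, TangentSpace (𝓡 4) x), IsOpen U → 𝓑.horizon ⊆ U → IsConnected 𝓑.horizon → ContMDiffOn (𝓡 4) ((𝓡 4).prod 𝓘(ℝ, Literature.Geometry.Lorentzian.E4)) ((⊤ : ℕ∞) : WithTop ℕ∞) (fun x ↦ (Bundle.TotalSpace.mk' Literature.Geometry.Lorentzian.E4 x (K x) : TangentBundle (𝓡 4) 𝓑.carrier)) U → (∀ x ∈ U, ∀ v w : TangentSpace (𝓡 4) x, 𝓑.metric.val x (𝓑.metric.leviCivita K x v) w + 𝓑.metric.val x v (𝓑.metric.leviCivita K x w) = 0)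 → (∀ x ∈ U, VectorField.mlieBracket (𝓡 4) 𝓑.killing K x = 0) → (∀ p ∈ 𝓑.horizon, K p ≠ 0) → (∀ γ : ℝ → 𝓑.carrier, IsMIntegralCurve γ K → γ 0 ∈ 𝓑.horizon → ∀ t, γ t ∈ 𝓑.horizon) → (∀ x ∈ U ∩ 𝓑.doc, 𝓑.metric.val x (K x) (K x) < 0) → (∃ S₀ : Set 𝓑.carrier, IsCompact S₀ ∧ S₀ ⊆ 𝓑.doc ∧ ∀ y ∈ 𝓑.doc, 0 ≤ 𝓑.metric.val y (𝓑.killing y) (𝓑.killing y) → y ∉ U → y ∈ Literature.Geometry.Lorentzian.stationaryOrbit 𝓑.killing S₀) → ∀ S : Set 𝓑.carrier, IsCompact S → S ⊆ 𝓑.doc → ∀ (γ : ℝ → 𝓑.carrier) (s : Set ℝ), Literature.Geometry.Lorentzian.IsMaximalGeodesicOn 𝓑.metric.toPseudoRiemannianMetric.leviCivita γ s → s.Nonempty → (∀ t ∈ s, 𝓑.metric.val (γ t) (Literature.Geometry.Lorentzian.velocity (𝓡 4) γ t) (Literature.Geometry.Lorentzian.velocity (𝓡 4) γ t) = 0 ∧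 Literature.Geometry.Lorentzian.velocity (𝓡 4) γ t ≠ 0 ∧ 𝓑.metric.val (γ t) (Literature.Geometry.Lorentzian.velocity (𝓡 4) γ t) (𝓑.killing (γ t)) = 0) → (∀ t ∈ s, γ t ∈ Literature.Geometry.Lorentzian.stationaryOrbit 𝓑.killing S) → ∃ (ν ω : ℝ) (ψ χ : 𝓑.carrier → ℝ), 0 < ν ∧ (∃ U : Set 𝓑.carrier, IsOpen U ∧ 𝓑.doc ∪ 𝓑.horizon ⊆ U ∧ ContMDiffOn (𝓡 4) 𝓘(ℝ, ℝ) ((⊤ : ℕ∞) : WithTop ℕ∞) ψ U ∧ ContMDiffOn (𝓡 4) 𝓘(ℝ, ℝ) ((⊤ : ℕ∞) : WithTop ℕ∞) χ U) ∧ (∀ x ∈ 𝓑.doc, 𝓑.metric.dalembertian ψ x = 0 ∧ 𝓑.metric.dalembertian χ x = 0) ∧ (∀ x ∈ 𝓑.doc, mfderiv (𝓡 4) 𝓘(ℝ, ℝ) ψ x (𝓑.killing x) = ν * ψ x - ω * χ x ∧ mfderiv (𝓡 4) 𝓘(ℝ, ℝ) χ x (𝓑.killing x) = ω * ψ x + ν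 * χ x) ∧ (∃ C : ℝ, ∀ x ∈ 𝓑.doc ∩ 𝓑.metric.chronologicalPast 𝓑.timeOrientation (𝓑.embed '' 𝓑.e.far (𝓑.e.R + 1)), |ψ x| ≤ C ∧ |χ x| ≤ C) ∧ ∃ x ∈ 𝓑.doc, ψ x ≠ 0 ∨ χ x ≠ 0 :=
  ergoregionBombModT_of_offWall_of_noDocLightPoints hOff
    (noDocLightPoints_of_belt_of_hovering hInc hHovB hHovC)

end Summit.FinalStateConjecture.FinalStateConjecture.Theorems.ErgoregionBombModT

end
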